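import Mathlib
import HarnessLib
import Summits.HubbardSuperconductivity.HubbardSuperconductivity.Theorems.ChiralWindowCwKLChiralWindowChannelOps
import Summits.HubbardSuperconductivity.HubbardSuperconductivity.Theorems.ChiralWindowCwKLChiralWindowRotPartner

/-!
# Crux `CwKLChiralWindow` (stmt-1741), line `Sketch`: the operator package of the `E_x` BLOCK

For `μ ∈ (-4,0)` the two-dimensional channel `E` of `D₄` splits under the axis reflection `s = sr 0`
(`(k₀,k₁) ↦ (k₀,-k₁)`) into the reflection-even block `E_x` and its quarter-turn image `E_y = U_r E_x`.  On the
`E_x` block the bottom of the compressed Lindhard operator is SIMPLE and the deflated Hilbert–Schmidt mass is HALF of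
the sector mass, which sharpens the Temple certificate of `…ChannelBoundR` (`d = 2`, mass `h`) to `d = 1`, mass `h/2`
(`…ChannelBoundX`).  This file assembles the operators (`kl_cbx_ops`): the integral operator `A` of the plain kernel
`χ₀(k+k')` (`stub_klKernelOp`, `stub_klKernelHS`), the isotypic projection `P = P_E = (1 - U_{r²})/2`
(`stub_klSectorProj`), the reflection `S = U_s`, the quarter turn `U₁ = U_r` and its cube `U₃ = U_{r³} = U₁*`
(`stub_klD4Unitary`), with the dihedral relations `S² = 1`, `S U₁ = U₃ S`, `U₁ U₃ = U₃ U₁ = 1`, the `E`-sector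
identities `U₁² v = -v`, `⟪v, U₁ v⟫ = 0`, and the HALVED deflated family bound
`Σ_j ‖A f_j - B f_j‖² ≤ ½ ∫∫ (K_E - Σ c u⊗u)²` over orthonormal families of `P`- and `S`-fixed vectors, for a deflation
`B = Σ c_m ⟨u_m,·⟩ u_m` whose kernel is rotation invariant.  The halving is the doubled-family argument: `(f_j, U₁ f_j)_j`
is again orthonormal — the cross terms `⟪f_i, U₁ f_j⟫` vanish by the `E`-sector skew-symmetry of `U₁`
(`kl_co_inner_rot_eq_zero`) combined with the reflection symmetry `S U₁ S = U₃` (`kl_cbx_cross_eq_zero`) — and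
`A P - B` commutes with the isometry `U₁` (`kl_cbx_deflation_comm`: the deflation commutes with `U₁` by the substitution
`k' ↦ rot k'`), so the sector bound applied to the doubled family counts every term twice (`kl_cbx_family_half`).
The abstract decomposition `v = ½(v + Sv) + ½(v - Sv)` of a `P`-fixed vector into an `E_x` vector and the `U₃`-image of
an `E_x` vector, orthogonal also for `⟪·, A ·⟫` (`kl_cbx_decomp`), transfers Rayleigh lower bounds from the block to the
whole sector (`kl_cbx_rayleigh_sector`).
-/

noncomputable section

set_option linter.dupNamespace false

namespace Summit.HubbardSuperconductivity.HubbardSuperconductivity.Theorems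

open MeasureTheory Literature.MathematicalPhysics.QuantumLattice

/-! ### Abstract Hilbert-space algebra of the block -/

/-- **Cross terms vanish.** In a real inner product space let `S` be a symmetric involution, `U₁` an operator with
`⟪U₁ φ, ψ⟫ = ⟪φ, U₃ ψ⟫` and `S U₁ = U₃ S`, skew on the fixed space of `P` (`⟪v, U₁ v⟫ = 0` for `P v = v`).  Then
`⟪a, U₁ b⟫ = 0` for all `P`- and `S`-fixed `a, b`: polarising the skew-symmetry gives `⟪a, U₁ b⟫ = -⟪b, U₁ a⟫`, while
conjugating by `S` gives `⟪a, U₁ b⟫ = ⟪a, U₃ b⟫ = ⟪U₁ a, b⟫`. [folklore] -/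
theorem kl_cbx_cross_eq_zero {H : Type*} [NormedAddCommGroup H] [InnerProductSpace ℝ H]
    {S U₁ U₃ P : H →L[ℝ] H}
    (hSS : S * S = 1) (hSsym : ∀ φ ψ, inner ℝ (S φ) ψ = inner ℝ φ (S ψ))
    (hSU : S * U₁ = U₃ * S) (hadj : ∀ φ ψ, inner ℝ (U₁ φ) ψ = inner ℝ φ (U₃ ψ))
    (hskew : ∀ v, P v = v → inner ℝ v (U₁ v) = 0)
    {a b : H} (ha : P a = a) (hb : P b = b) (hSa : S a = a) (hSb : S b = b) :
    inner ℝ a (U₁ b) = 0 := by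
  have h1 : inner ℝ a (U₁ b) + inner ℝ b (U₁ a) = 0 := by
    have hab := hskew (a + b) (by rw [map_add, ha, hb])
    rw [map_add, inner_add_left, inner_add_right, inner_add_right, hskew a ha, hskew b hb] at hab
    linarith
  have h2 : inner ℝ a (U₁ b) = inner ℝ b (U₁ a) := by
    calc inner ℝ a (U₁ b) = inner ℝ (S a) (U₁ (S b)) := by rw [hSa, hSb]
      _ = inner ℝ a ((S * U₁) (S b)) := by rw [hSsym, mul_apply_eq_comp]
      _ = inner ℝ a (U₃ ((S * S) b)) := by rw [hSU, mul_apply_eq_comp, mul_apply_eq_comp]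
      _ = inner ℝ b (U₁ a) := by rw [hSS, one_apply_eq_self, ← hadj, real_inner_comm]
  linarith

/-- **The doubled family.** If `X` commutes with an isometry `U₁`, `Σ_i ‖X g_i‖² ≤ h` for every finite orthonormal
family `g`, and `f` is an orthonormal family with `⟪f_i, U₁ f_j⟫ = 0` for all `i, j`, then `Σ_j ‖X f_j‖² ≤ h/2`: the family
`(f, U₁ ∘ f)` indexed by `Fin m ⊕ Fin m ≃ Fin (m + m)` is orthonormal and `‖X (U₁ f_j)‖ = ‖U₁ (X f_j)‖ = ‖X f_j‖`.
[folklore] -/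
theorem kl_cbx_family_half {H : Type*} [NormedAddCommGroup H] [InnerProductSpace ℝ H]
    {X U₁ : H →L[ℝ] H} (hXU : X * U₁ = U₁ * X)
    (hUinner : ∀ φ ψ, inner ℝ (U₁ φ) (U₁ ψ) = inner ℝ φ ψ) {h : ℝ}
    (hHS : ∀ (n : ℕ) (g : Fin n → H), Orthonormal ℝ g → ∑ i, ‖X (g i)‖ ^ 2 ≤ h)
    {m : ℕ} {f : Fin m → H} (hf : Orthonormal ℝ f) (hcross : ∀ i j, inner ℝ (f i) (U₁ (f j)) = 0) :
    ∑ j, ‖X (f j)‖ ^ 2 ≤ h / 2 := by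
  set g' : Fin m ⊕ Fin m → H := Sum.elim f (fun j => U₁ (f j)) with hg'
  have hg'o : Orthonormal ℝ g' := by
    rw [orthonormal_iff_ite] at hf ⊢
    rintro (i | i) (j | j)
    · simp only [hg', Sum.elim_inl, Sum.inl.injEq]
      exact hf i j
    · simp only [hg', Sum.elim_inl, Sum.elim_inr, reduceCtorEq, ↓reduceIte]
      exact hcross i j
    · simp only [hg', Sum.elim_inl, Sum.elim_inr, reduceCtorEq, ↓reduceIte]
      rw [real_inner_comm]
      exact hcross j i
    · simp only [hg', Sum.elim_inr, Sum.inr.injEq]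
      rw [hUinner]
      exact hf i j
  have hgo : Orthonormal ℝ (g' ∘ finSumFinEquiv.symm) := hg'o.comp _ finSumFinEquiv.symm.injective
  have h1 := hHS (m + m) (g' ∘ finSumFinEquiv.symm) hgo
  have h2 : ∑ i, ‖X ((g' ∘ finSumFinEquiv.symm) i)‖ ^ 2 = ∑ s, ‖X (g' s)‖ ^ 2 :=
    Equiv.sum_comp finSumFinEquiv.symm (fun s => ‖X (g' s)‖ ^ 2)
  have hnorm : ∀ w : H, ‖U₁ w‖ ^ 2 = ‖w‖ ^ 2 := fun w => by
    rw [← real_inner_self_eq_norm_sq, ← real_inner_self_eq_norm_sq, hUinner]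
  have h3 : ∑ s, ‖X (g' s)‖ ^ 2 = 2 * ∑ j, ‖X (f j)‖ ^ 2 := by
    rw [Fintype.sum_sum_type]
    simp only [hg', Sum.elim_inl, Sum.elim_inr]
    have : ∀ j, ‖X (U₁ (f j))‖ ^ 2 = ‖X (f j)‖ ^ 2 := fun j => by
      rw [← mul_apply_eq_comp, hXU, mul_apply_eq_comp, hnorm]
    simp only [this]
    ring
  rw [h2, h3] at h1
  linarith

/-- **Block decomposition of a sector vector.** With `A` commuting with the symmetric involution `S` and with the
isometry `U₁`, `P` commuting with both, `S U₁ = U₃ S` and `U₃ v = -U₁ v` on the fixed space of `P`: for `P v = v` the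
vectors `p = ½(v + Sv)` and `w = U₁ (½(v - Sv))` are both `P`- and `S`-fixed, `⟪v, Av⟫ = ⟪p, Ap⟫ + ⟪w, Aw⟫` and
`‖v‖² = ‖p‖² + ‖w‖²` (`S` is an isometry, `p` is `S`-even and `q = ½(v - Sv)` is `S`-odd, so `p ⊥ q`, `p ⊥ Aq`, `q ⊥ Ap`;
`S U₁ q = U₃ S q = -U₃ q = U₁ q`). [folklore] -/
theorem kl_cbx_decomp {H : Type*} [NormedAddCommGroup H] [InnerProductSpace ℝ H]
    {A P S U₁ U₃ : H →L[ℝ] H}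
    (hAS : A * S = S * A) (hAU : A * U₁ = U₁ * A) (hPS : S * P = P * S) (hPU : P * U₁ = U₁ * P)
    (hSS : S * S = 1) (hSsym : ∀ φ ψ, inner ℝ (S φ) ψ = inner ℝ φ (S ψ))
    (hSU : S * U₁ = U₃ * S) (hUinner : ∀ φ ψ, inner ℝ (U₁ φ) (U₁ ψ) = inner ℝ φ ψ)
    (hU₃ : ∀ v, P v = v → U₃ v = -U₁ v) {v : H} (hv : P v = v) :
    (P ((1 / 2 : ℝ) • (v + S v)) = (1 / 2 : ℝ) • (v + S v) ∧ S ((1 / 2 : ℝ) • (v + S v)) = (1 / 2 : ℝ) • (v + S v)) ∧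
    (P (U₁ ((1 / 2 : ℝ) • (v - S v))) = U₁ ((1 / 2 : ℝ) • (v - S v)) ∧
      S (U₁ ((1 / 2 : ℝ) • (v - S v))) = U₁ ((1 / 2 : ℝ) • (v - S v))) ∧
    inner ℝ v (A v) = inner ℝ ((1 / 2 : ℝ) • (v + S v)) (A ((1 / 2 : ℝ) • (v + S v))) +
      inner ℝ (U₁ ((1 / 2 : ℝ) • (v - S v))) (A (U₁ ((1 / 2 : ℝ) • (v - S v)))) ∧
    ‖v‖ ^ 2 = ‖(1 / 2 : ℝ) • (v + S v)‖ ^ 2 + ‖U₁ ((1 / 2 : ℝ) • (v - S v))‖ ^ 2 := by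
  set p : H := (1 / 2 : ℝ) • (v + S v) with hp
  set q : H := (1 / 2 : ℝ) • (v - S v) with hq
  have hSSv : ∀ w, S (S w) = w := fun w => by rw [← mul_apply_eq_comp, hSS, one_apply_eq_self]
  have hPSv : P (S v) = S v := by rw [← mul_apply_eq_comp, ← hPS, mul_apply_eq_comp, hv]
  have hpq : p + q = v := by
    simp only [hp, hq, ← smul_add]
    rw [add_add_sub_cancel, ← two_smul ℝ v, smul_smul]; norm_num
  have hSp : S p = p := by
    simp only [hp, map_smul, map_add, hSSv]; rw [add_comm]
  have hSq : S q = -q := by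
    simp only [hq, map_smul, map_sub, hSSv, ← smul_neg, neg_sub]
  have hPp : P p = p := by simp only [hp, map_smul, map_add, hv, hPSv]
  have hPq : P q = q := by simp only [hq, map_smul, map_sub, hv, hPSv]
  have hSiso : ∀ a b : H, inner ℝ (S a) (S b) = inner ℝ a b := fun a b => by rw [hSsym, hSSv]
  have horth : inner ℝ p q = 0 := by
    have := hSiso p q
    rw [hSp, hSq, inner_neg_right] at this
    linarith
  have hSA : ∀ w, S (A w) = A (S w) := fun w => by rw [← mul_apply_eq_comp, ← hAS, mul_apply_eq_comp]
  have hApq : inner ℝ p (A q) = 0 := by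
    have := hSiso p (A q)
    rw [hSp, hSA, hSq, map_neg, inner_neg_right] at this
    linarith
  have hAqp : inner ℝ q (A p) = 0 := by
    have := hSiso q (A p)
    rw [hSq, hSA, hSp, inner_neg_left] at this
    linarith
  -- the rotated odd part
  have hPw : P (U₁ q) = U₁ q := by rw [← mul_apply_eq_comp, hPU, mul_apply_eq_comp, hPq]
  have hSw : S (U₁ q) = U₁ q := by
    rw [← mul_apply_eq_comp, hSU, mul_apply_eq_comp, hSq, map_neg, hU₃ q hPq, neg_neg]
  have hAw : inner ℝ (U₁ q) (A (U₁ q)) = inner ℝ q (A q) := by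
    rw [← mul_apply_eq_comp A U₁, hAU, mul_apply_eq_comp, hUinner]
  have hnw : ‖U₁ q‖ ^ 2 = ‖q‖ ^ 2 := by
    rw [← real_inner_self_eq_norm_sq, ← real_inner_self_eq_norm_sq, hUinner]
  refine ⟨⟨hPp, hSp⟩, ⟨hPw, hSw⟩, ?_, ?_⟩
  · rw [hAw]
    conv_lhs => rw [← hpq]
    rw [map_add, inner_add_left, inner_add_right, inner_add_right, hApq, hAqp, add_zero, zero_add]
  · rw [hnw]
    conv_lhs => rw [← hpq]
    have := norm_add_sq_eq_norm_sq_add_norm_sq_real horth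
    nlinarith [this]

/-- **Rayleigh bound: from the block to the sector.** In the setting of `kl_cbx_decomp`, a lower bound
`l ‖v‖² ≤ ⟪v, Av⟫` on the `P`- and `S`-fixed vectors holds on all `P`-fixed vectors. [folklore] -/
theorem kl_cbx_rayleigh_sector {H : Type*} [NormedAddCommGroup H] [InnerProductSpace ℝ H]
    {A P S U₁ U₃ : H →L[ℝ] H}
    (hAS : A * S = S * A) (hAU : A * U₁ = U₁ * A) (hPS : S * P = P * S) (hPU : P * U₁ = U₁ * P)
    (hSS : S * S = 1) (hSsym : ∀ φ ψ, inner ℝ (S φ) ψ = inner ℝ φ (S ψ))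
    (hSU : S * U₁ = U₃ * S) (hUinner : ∀ φ ψ, inner ℝ (U₁ φ) (U₁ ψ) = inner ℝ φ ψ)
    (hU₃ : ∀ v, P v = v → U₃ v = -U₁ v) {l : ℝ}
    (hray : ∀ v, P v = v → S v = v → l * ‖v‖ ^ 2 ≤ inner ℝ v (A v)) {v : H} (hv : P v = v) :
    l * ‖v‖ ^ 2 ≤ inner ℝ v (A v) := by
  obtain ⟨⟨hPp, hSp⟩, ⟨hPw, hSw⟩, hinner, hnorm⟩ := kl_cbx_decomp hAS hAU hPS hPU hSS hSsym hSU hUinner hU₃ hv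
  rw [hinner, hnorm, mul_add]
  exact add_le_add (hray _ hPp hSp) (hray _ hPw hSw)

/-! ### The concrete operators on `L²(σ_μ)` -/

/-- **The deflation commutes with the quarter turn.** A finite-rank `B = Σ c_m ⟨u_m,·⟩ u_m` (`u_m ∈ L²(σ_μ)`) whose kernel
`D(k,k') = Σ c_m u_m(k) u_m(k')` is rotation invariant, `D(rot k, rot k') = D(k,k')`, commutes with every bounded `U₁` acting
a.e. as `φ ↦ φ ∘ rot` (compare a.e. representatives, `kl_sk_finiteRank_ae`; substitute `k' ↦ rot k'` in the kernel integral,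
`kl_rp_integral_comp_rot`). [folklore] -/
theorem kl_cbx_deflation_comm {μ : ℝ} (hμ : μ ∈ Set.Ioo (-4 : ℝ) 0) {M : ℕ} (c : Fin M → ℝ)
    {u : Fin M → Momentum → ℝ} (hu : ∀ m, MemLp (u m) 2 (fermiCurveMeasure (squareDispersion 1 0) μ))
    (hDrot : ∀ k k', ∑ m, c m * (u m (rotMomentum k) * u m (rotMomentum k')) = ∑ m, c m * (u m k * u m k'))
    (U₁ : Lp ℝ 2 (fermiCurveMeasure (squareDispersion 1 0) μ) →L[ℝ] Lp ℝ 2 (fermiCurveMeasure (squareDispersion 1 0) μ))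
    (hU₁ae : ∀ φ : Lp ℝ 2 (fermiCurveMeasure (squareDispersion 1 0) μ),
      (U₁ φ : Momentum → ℝ) =ᵐ[fermiCurveMeasure (squareDispersion 1 0) μ] fun k => φ (rotMomentum k)) :
    (∑ m, c m • (innerSL ℝ ((hu m).toLp (u m))).smulRight ((hu m).toLp (u m))) * U₁ =
      U₁ * ∑ m, c m • (innerSL ℝ ((hu m).toLp (u m))).smulRight ((hu m).toLp (u m)) := by
  have hrot : MeasurePreserving rotMomentum (fermiCurveMeasure (squareDispersion 1 0) μ)
      (fermiCurveMeasure (squareDispersion 1 0) μ) := stub_klD4Invariant stub_klGradient μ hμ (DihedralGroup.r 1)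
  refine ContinuousLinearMap.ext fun φ => Lp.ext ?_
  rw [mul_apply_eq_comp, mul_apply_eq_comp]
  filter_upwards [kl_sk_finiteRank_ae c hu (U₁ φ), hU₁ae ((∑ m, c m • (innerSL ℝ ((hu m).toLp (u m))).smulRight ((hu m).toLp (u m))) φ),
    hrot.quasiMeasurePreserving.ae_eq (kl_sk_finiteRank_ae c hu φ)] with k hk1 hk2 hk3
  rw [hk1, hk2]
  simp only [Function.comp_apply] at hk3
  rw [hk3]
  have h1 : ∫ y, (∑ m, c m * (u m k * u m y)) * (U₁ φ : Momentum → ℝ) y ∂fermiCurveMeasure (squareDispersion 1 0) μ =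
      ∫ y, (∑ m, c m * (u m k * u m y)) * φ (rotMomentum y) ∂fermiCurveMeasure (squareDispersion 1 0) μ :=
    integral_congr_ae (by filter_upwards [hU₁ae φ] with y hy; rw [hy])
  rw [h1, ← kl_rp_integral_comp_rot hμ (fun y => (∑ m, c m * (u m (rotMomentum k) * u m y)) * φ y)]
  simp only [hDrot]

/-- **The reflection fixes the class of a reflection-even function** (`S` acting a.e. as `φ ↦ φ ∘ refl`, `refl`
preserving `σ_μ`). [folklore] -/
theorem kl_cbx_refl_toLp {μ : ℝ} (hμ : μ ∈ Set.Ioo (-4 : ℝ) 0)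
    (S : Lp ℝ 2 (fermiCurveMeasure (squareDispersion 1 0) μ) →L[ℝ] Lp ℝ 2 (fermiCurveMeasure (squareDispersion 1 0) μ))
    (hSae : ∀ φ : Lp ℝ 2 (fermiCurveMeasure (squareDispersion 1 0) μ),
      (S φ : Momentum → ℝ) =ᵐ[fermiCurveMeasure (squareDispersion 1 0) μ] fun k => φ (reflMomentum k))
    {Φ : Momentum → ℝ} (hΦ : MemLp Φ 2 (fermiCurveMeasure (squareDispersion 1 0) μ))
    (hΦrefl : ∀ k, Φ (reflMomentum k) = Φ k) : S (hΦ.toLp Φ) = hΦ.toLp Φ := by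
  have hrefl : MeasurePreserving reflMomentum (fermiCurveMeasure (squareDispersion 1 0) μ)
      (fermiCurveMeasure (squareDispersion 1 0) μ) := stub_klD4Invariant stub_klGradient μ hμ (DihedralGroup.sr 0)
  refine Lp.ext ?_
  filter_upwards [hSae (hΦ.toLp Φ), hrefl.quasiMeasurePreserving.ae_eq hΦ.coeFn_toLp, hΦ.coeFn_toLp]
    with k hk1 hk2 hk3
  simp only [Function.comp_apply] at hk2
  rw [hk1, hk2, hΦrefl, hk3]

set_option maxHeartbeats 400000 in
/-- **The operator package of the `E_x` block** (`kl_cbx_ops`). For `μ ∈ (-4,0)` and an admissible deflation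
`(c_m ≥ 0, u_m ∈ L²(σ_μ))` with rotation-invariant kernel there are bounded operators `A, P, S, U₁, U₃` on `L²(σ_μ)`: `A` the
integral operator of `χ₀(k+k')` (a.e. action, matrix elements, self-adjoint, compact), `P` the isotypic projection of `E`
(commuting with `A`, fixing `E`-channel functions, with `E`-channel representatives on its range), `U₁` the quarter turn
(a.e. `φ ∘ rot`, commuting with `A` and `P`, isometric, `U₁* = U₃ = U₁³`, `U₁ U₃ = U₃ U₁ = 1`, and on the `E` sector
`⟪v, U₁ v⟫ = 0`, `U₁² v = -v`, `U₃ v = -U₁ v`), `S` the axis reflection (a.e. `φ ∘ refl`, `S² = 1`, commuting with `A` and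
`P`, symmetric, `S U₁ = U₃ S`), together with the HALVED deflated Hilbert–Schmidt family bound on orthonormal families of
`P`- and `S`-fixed vectors and the positivity of the deflation. [folklore] -/
theorem kl_cbx_ops : ∀ μ ∈ Set.Ioo (-4 : ℝ) 0, ∀ (M : ℕ) (c : Fin M → ℝ) (u : Fin M → Momentum → ℝ)
    (hu : ∀ m, MemLp (u m) 2 (fermiCurveMeasure (squareDispersion 1 0) μ)), (∀ m, 0 ≤ c m) →
    (∀ k k', ∑ m, c m * (u m (rotMomentum k) * u m (rotMomentum k')) = ∑ m, c m * (u m k * u m k')) →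
    ∃ A P S U₁ U₃ : Lp ℝ 2 (fermiCurveMeasure (squareDispersion 1 0) μ) →L[ℝ] Lp ℝ 2 (fermiCurveMeasure (squareDispersion 1 0) μ),
      (∀ φ : Lp ℝ 2 (fermiCurveMeasure (squareDispersion 1 0) μ),
        (A φ : Momentum → ℝ) =ᵐ[fermiCurveMeasure (squareDispersion 1 0) μ]
          fun k => ∫ k', lindhardFunction (squareDispersion 1 0) μ (k + k') * φ k'
            ∂fermiCurveMeasure (squareDispersion 1 0) μ) ∧
      (∀ φ ψ : Lp ℝ 2 (fermiCurveMeasure (squareDispersion 1 0) μ),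
        inner ℝ ψ (A φ) = ∫ k, ψ k * ∫ k', lindhardFunction (squareDispersion 1 0) μ (k + k') * φ k'
          ∂fermiCurveMeasure (squareDispersion 1 0) μ ∂fermiCurveMeasure (squareDispersion 1 0) μ) ∧
      IsSelfAdjoint A ∧ IsCompactOperator A ∧ A * P = P * A ∧
      P * P = P ∧ IsSelfAdjoint P ∧ P = (1 / 2 : ℝ) • (1 - U₁ * U₁) ∧
      (∀ φ : Lp ℝ 2 (fermiCurveMeasure (squareDispersion 1 0) μ),
        (P φ : Momentum → ℝ) =ᵐ[fermiCurveMeasure (squareDispersion 1 0) μ] fun k => d4Project D4Irrep.E φ k) ∧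
      (∀ (ψ : Momentum → ℝ) (hψ : MemLp ψ 2 (fermiCurveMeasure (squareDispersion 1 0) μ)),
        InChannel D4Irrep.E ψ → P (hψ.toLp ψ) = hψ.toLp ψ) ∧
      (∀ φ : Lp ℝ 2 (fermiCurveMeasure (squareDispersion 1 0) μ), P φ = φ →
        ∃ ψ : Momentum → ℝ, InChannel D4Irrep.E ψ ∧ MemLp ψ 2 (fermiCurveMeasure (squareDispersion 1 0) μ) ∧
          (φ : Momentum → ℝ) =ᵐ[fermiCurveMeasure (squareDispersion 1 0) μ] ψ) ∧
      (∀ φ : Lp ℝ 2 (fermiCurveMeasure (squareDispersion 1 0) μ),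
        (U₁ φ : Momentum → ℝ) =ᵐ[fermiCurveMeasure (squareDispersion 1 0) μ] fun k => φ (rotMomentum k)) ∧
      A * U₁ = U₁ * A ∧ P * U₁ = U₁ * P ∧
      (∀ φ ψ : Lp ℝ 2 (fermiCurveMeasure (squareDispersion 1 0) μ), inner ℝ (U₁ φ) (U₁ ψ) = inner ℝ φ ψ) ∧
      (∀ φ ψ : Lp ℝ 2 (fermiCurveMeasure (squareDispersion 1 0) μ), inner ℝ (U₁ φ) ψ = inner ℝ φ (U₃ ψ)) ∧
      U₃ = U₁ * U₁ * U₁ ∧ U₁ * U₃ = 1 ∧ U₃ * U₁ = 1 ∧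
      (∀ v : Lp ℝ 2 (fermiCurveMeasure (squareDispersion 1 0) μ), P v = v → inner ℝ v (U₁ v) = 0) ∧
      (∀ v : Lp ℝ 2 (fermiCurveMeasure (squareDispersion 1 0) μ), P v = v → U₁ (U₁ v) = -v) ∧
      (∀ v : Lp ℝ 2 (fermiCurveMeasure (squareDispersion 1 0) μ), P v = v → U₃ v = -U₁ v) ∧
      (∀ φ : Lp ℝ 2 (fermiCurveMeasure (squareDispersion 1 0) μ),
        (S φ : Momentum → ℝ) =ᵐ[fermiCurveMeasure (squareDispersion 1 0) μ] fun k => φ (reflMomentum k)) ∧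
      S * S = 1 ∧ A * S = S * A ∧ S * P = P * S ∧
      (∀ φ ψ : Lp ℝ 2 (fermiCurveMeasure (squareDispersion 1 0) μ), inner ℝ (S φ) ψ = inner ℝ φ (S ψ)) ∧
      S * U₁ = U₃ * S ∧
      (∀ (m : ℕ) (f : Fin m → Lp ℝ 2 (fermiCurveMeasure (squareDispersion 1 0) μ)), Orthonormal ℝ f →
        (∀ j, P (f j) = f j) → (∀ j, S (f j) = f j) →
        ∑ j, ‖A (f j) - (∑ m, c m • (innerSL ℝ ((hu m).toLp (u m))).smulRight ((hu m).toLp (u m))) (f j)‖ ^ 2 ≤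
          (∫ z, (d4Project D4Irrep.E (fun q => lindhardFunction (squareDispersion 1 0) μ (z.1 + q)) z.2 -
              ∑ m, c m * (u m z.1 * u m z.2)) ^ 2
            ∂(fermiCurveMeasure (squareDispersion 1 0) μ).prod (fermiCurveMeasure (squareDispersion 1 0) μ)) / 2) ∧
      (∀ φ : Lp ℝ 2 (fermiCurveMeasure (squareDispersion 1 0) μ),
        0 ≤ inner ℝ φ ((∑ m, c m • (innerSL ℝ ((hu m).toLp (u m))).smulRight ((hu m).toLp (u m))) φ)) := by
  intro μ hμ M c u hu hc hDrot
  haveI : IsFiniteMeasure (fermiCurveMeasure (squareDispersion 1 0) μ) :=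
    stub_klFiniteMeasure stub_klGradient stub_klHausdorffFinite μ hμ
  -- the kernel operator
  have hκ2 : MemLp (Function.uncurry fun k q : Momentum => lindhardFunction (squareDispersion 1 0) μ (k + q)) 2
      ((fermiCurveMeasure (squareDispersion 1 0) μ).prod (fermiCurveMeasure (squareDispersion 1 0) μ)) :=
    stub_klKernelHS μ hμ
  obtain ⟨⟨A, hA⟩, hAprops⟩ :=
    stub_klKernelOp μ hμ (fun k q : Momentum => lindhardFunction (squareDispersion 1 0) μ (k + q)) hκ2
  obtain ⟨hAc, hAsa', -, hAinner⟩ := hAprops A hA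
  have hAsa : IsSelfAdjoint A := hAsa' fun k q => by rw [add_comm k q]
  -- the composition operators and the projection
  obtain ⟨U, hUae, -, hU1, hUmul, hUinner, hUadj, hUcomm⟩ := stub_klD4Unitary μ hμ
  have hAU : ∀ g : DihedralGroup 4, A * U g = U g * A :=
    hUcomm (fun k q : Momentum => lindhardFunction (squareDispersion 1 0) μ (k + q)) A
      (fun g k q => by rw [← kl_co_d4Momentum_add, stub_klLindhardD4]) hκ2 hA
  obtain ⟨P, -, hPae, hPP, hPsa, hPU, hPfix, hPrepr, hPE⟩ := stub_klSectorProj μ hμ U hUae hU1 hUmul hUadj D4Irrep.E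
  have hAP : A * P = P * A := by
    rw [hPE rfl, mul_smul_comm, smul_mul_assoc, mul_sub, sub_mul, mul_one, one_mul, hAU]
  -- group bookkeeping
  have hSS : U (DihedralGroup.sr 0) * U (DihedralGroup.sr 0) = 1 := by
    rw [hUmul, show (DihedralGroup.sr 0 : DihedralGroup 4) * DihedralGroup.sr 0 = 1 by decide, hU1]
  have hSsym : ∀ φ ψ : Lp ℝ 2 (fermiCurveMeasure (squareDispersion 1 0) μ),
      inner ℝ (U (DihedralGroup.sr 0) φ) ψ = inner ℝ φ (U (DihedralGroup.sr 0) ψ) := fun φ ψ => by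
    rw [hUadj, show (DihedralGroup.sr 0 : DihedralGroup 4)⁻¹ = DihedralGroup.sr 0 by decide]
  have hadj : ∀ φ ψ : Lp ℝ 2 (fermiCurveMeasure (squareDispersion 1 0) μ),
      inner ℝ (U (DihedralGroup.r 1) φ) ψ = inner ℝ φ (U (DihedralGroup.r 3) ψ) := fun φ ψ => by
    rw [hUadj, show (DihedralGroup.r 1 : DihedralGroup 4)⁻¹ = DihedralGroup.r 3 by decide]
  have hU₃ : U (DihedralGroup.r 3) = U (DihedralGroup.r 1) * U (DihedralGroup.r 1) * U (DihedralGroup.r 1) := by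
    rw [hUmul, hUmul, show (DihedralGroup.r 1 : DihedralGroup 4) * (DihedralGroup.r 1 * DihedralGroup.r 1) =
      DihedralGroup.r 3 by decide]
  have hSU : U (DihedralGroup.sr 0) * U (DihedralGroup.r 1) = U (DihedralGroup.r 3) * U (DihedralGroup.sr 0) := by
    rw [hUmul, hUmul, show (DihedralGroup.r 1 : DihedralGroup 4) * DihedralGroup.sr 0 =
      DihedralGroup.sr 0 * DihedralGroup.r 3 by decide]
  have h13 : U (DihedralGroup.r 1) * U (DihedralGroup.r 3) = 1 := by
    rw [hUmul, show (DihedralGroup.r 3 : DihedralGroup 4) * DihedralGroup.r 1 = 1 by decide, hU1]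
  have h31 : U (DihedralGroup.r 3) * U (DihedralGroup.r 1) = 1 := by
    rw [hUmul, show (DihedralGroup.r 1 : DihedralGroup 4) * DihedralGroup.r 3 = 1 by decide, hU1]
  have hskew : ∀ v : Lp ℝ 2 (fermiCurveMeasure (squareDispersion 1 0) μ), P v = v →
      inner ℝ v (U (DihedralGroup.r 1) v) = 0 := fun v hv => kl_co_inner_rot_eq_zero U hUmul hUinner (hPE rfl) hv
  have hr2 : U (DihedralGroup.r 2) = U (DihedralGroup.r 1) * U (DihedralGroup.r 1) := by
    rw [hUmul, show (DihedralGroup.r 1 : DihedralGroup 4) * DihedralGroup.r 1 = DihedralGroup.r 2 by decide]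
  have hPdef : P = (1 / 2 : ℝ) • (1 - U (DihedralGroup.r 1) * U (DihedralGroup.r 1)) := by rw [← hr2]; exact hPE rfl
  have hrot2 : ∀ v : Lp ℝ 2 (fermiCurveMeasure (squareDispersion 1 0) μ), P v = v →
      U (DihedralGroup.r 1) (U (DihedralGroup.r 1) v) = -v := by
    intro v hv
    have h := hv
    rw [hPE rfl, smul_apply, sub_apply, one_apply_eq_self] at h
    have h3 : (2 : ℝ) • ((1 / 2 : ℝ) • (v - U (DihedralGroup.r 2) v)) = (2 : ℝ) • v := by rw [h]
    rw [smul_smul, show (2 : ℝ) * (1 / 2) = 1 by norm_num, one_smul, two_smul] at h3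
    rw [← mul_apply_eq_comp, ← hr2]
    calc U (DihedralGroup.r 2) v = v - (v - U (DihedralGroup.r 2) v) := by abel
      _ = -v := by rw [h3]; abel
  have hneg : ∀ v : Lp ℝ 2 (fermiCurveMeasure (squareDispersion 1 0) μ), P v = v →
      U (DihedralGroup.r 3) v = -U (DihedralGroup.r 1) v := fun v hv => by
    rw [hU₃, mul_apply_eq_comp, mul_apply_eq_comp, hrot2 v hv, map_neg]
  -- the deflation and the halved family bound
  obtain ⟨hK'2, hK'ae, hBpos⟩ := stub_klSectorKernel μ hμ D4Irrep.E A P hA hPae M c u hu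
  have hHS' := ((stub_klKernelOp μ hμ _ hK'2).2 _ hK'ae).2.2.1
  have hBU := kl_cbx_deflation_comm hμ c hu hDrot (U (DihedralGroup.r 1)) (fun φ => hUae (DihedralGroup.r 1) φ)
  have hXU : (A * P - ∑ m, c m • (innerSL ℝ ((hu m).toLp (u m))).smulRight ((hu m).toLp (u m))) *
      U (DihedralGroup.r 1) = U (DihedralGroup.r 1) *
        (A * P - ∑ m, c m • (innerSL ℝ ((hu m).toLp (u m))).smulRight ((hu m).toLp (u m))) := by
    rw [sub_mul, mul_sub, hBU, mul_assoc, ← hPU, ← mul_assoc, hAU, mul_assoc]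
  refine ⟨A, P, U (DihedralGroup.sr 0), U (DihedralGroup.r 1), U (DihedralGroup.r 3), hA, hAinner, hAsa, hAc, hAP,
    hPP, hPsa, hPdef, hPae, hPfix, hPrepr, fun φ => hUae (DihedralGroup.r 1) φ, hAU _, (hPU _).symm, hUinner _, hadj,
    hU₃, h13, h31, hskew, hrot2, hneg, fun φ => hUae (DihedralGroup.sr 0) φ, hSS, hAU _, hPU _, hSsym, hSU, ?_, hBpos hc⟩
  intro m f hf hPf hSf
  have hcross : ∀ i j, inner ℝ (f i) (U (DihedralGroup.r 1) (f j)) = 0 := fun i j =>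
    kl_cbx_cross_eq_zero hSS hSsym hSU hadj hskew (hPf i) (hPf j) (hSf i) (hSf j)
  have h1 := kl_cbx_family_half hXU (hUinner _) hHS' hf hcross
  refine le_of_eq_of_le (Finset.sum_congr rfl fun j _ => ?_) h1
  rw [sub_apply, mul_apply_eq_comp, hPf j]

end Summit.HubbardSuperconductivity.HubbardSuperconductivity.Theorems

end
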